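import Summits.NavierStokesRegularity.FunctionalMining.QuadraticBudgetStatic
import Summits.NavierStokesRegularity.FunctionalMining.QuadraticBudgetPlanting
import Summits.NavierStokesRegularity.FunctionalMining.QuadraticBudgetWitness
import HarnessLib

/-!
# Functional mining, NO-GO #2: the quadratic enstrophy budget fails on `T³` for every constant

Search for candidate a priori estimates; no regularity claim.

Cell `pub-nsfunc` (host summit NavierStokesRegularity, topic `FunctionalMining`), NO-GO branch.
Census row C1 of the cell's dictionary is the Grönwall-closable candidate

  `dℰ/dt ≤ (C/ν) ℰ²` along every zero-mean classical solution of unforced Navier–Stokes on `T³`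

(`EnstrophyQuadraticBudget C`, `RateBudgets.lean`; `ℰ = ½‖∇u‖₂²`; closable because
`∫ ℰ dt ≤ K₀/(2ν)`). Its Navier–Stokes scaling degree `2` is one unit below the degree
`3 = s_ℰ + 2` that Sieve 1 (`Sieves.lean`) forces on every universal monomial budget, so it was
filed EXPECTED FALSE. This file closes the row inside the tree, for EVERY real `C`
(`not_enstrophyQuadraticBudget`), by assembling

* the static reduction `σ² ≤ 4 C ℰ² D` at smooth divergence-free zero-mean data and the
  scaling-family criterion (`QuadraticBudgetStatic.lean`: local existence on `T³`, the `H¹`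
  balance at `t = 0`, amplitude ray);
* the whole-space seed: a smooth compactly supported divergence-free `U` on `ℝ³` with production
  `σ(U) > 0` (`QuadraticBudgetWitness.lean`, sign forced by a perturbative argument — no
  transcendental integral is evaluated);
* concentration `y ↦ c U(c(y − q))` at the cube centre, `c = 8n`, and periodisation onto `T³`
  with the exact scaling laws `σ ↦ c³σ`, `ℰ ↦ cℰ`, `D ↦ c³D` (`QuadraticBudgetPlanting.lean`).

Reading for the census (DERIVATIVES.md §6, NOGO.md): the cell's second kernel-checked no-go
entry — class `{ℰ}`, budget `G = C ℰ²/ν` (every `C`), witness = planted concentrating bumps,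
verdict REFUTED (Lean), scope: all `ν > 0`, unit torus, zero-mean classical solutions. The
extreme-growth literature (Lu–Doering 2008) shows the cubic law `dℰ/dt ≲ ℰ³/ν³` is attained
instantaneously; the present statement is the elementary, fully formal counterpart that NO
quadratic law holds, obtained from scaling alone.
-/

noncomputable section

open MeasureTheory Set Filter Topology InnerProductSpace Metric
open scoped RealInnerProductSpace Laplacian ContDiff

namespace Summit.NavierStokesRegularity.FunctionalMining

open Literature.Analysis.FunctionSpaces Literature.Analysis.FluidPDE

/-- **Planted family member.** For the whole-space witness `U` (smooth, supported in `B̄(0,2)`,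
divergence free), the cube centre `q` and a scale `c ≥ 8`, the planted field
`periodize (y ↦ c U(c (y − q)))` is a smooth divergence-free zero-mean field on `T³` whose
enstrophy production, enstrophy and Laplacian dissipation are `c³ σ(U)`, `½ c ‖∇U‖₂²`,
`c³ ∫‖ΔU‖²`. [folklore] -/
theorem planted_facts {U : EuclideanSpace ℝ (Fin 3) → EuclideanSpace ℝ (Fin 3)}
    (hU : ContDiff ℝ ∞ U) (hUs : tsupport U ⊆ Metric.closedBall 0 2)
    (hdiv : ∀ y, VectorCalculus.divergence U y = 0) {q : EuclideanSpace ℝ (Fin 3)}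
    (hq : ∀ i, q i = 1 / 2) {c : ℝ} (hc : 8 ≤ c) :
    Torus.IsSmooth (Torus.periodize fun y => c • U (c • (y + -q))) ∧
      Torus.IsDivFree (Torus.periodize fun y => c • U (c • (y + -q))) ∧
      Torus.HasZeroMean (Torus.periodize fun y => c • U (c • (y + -q))) ∧
      enstrophyProduction (Torus.periodize fun y => c • U (c • (y + -q))) =
        c ^ 3 * ∫ z, ⟪fderiv ℝ U z (U z), Δ U z⟫ ∧
      torusEnstrophy (Torus.periodize fun y => c • U (c • (y + -q))) =
        2⁻¹ * (c * ∫ z, ∑ i, ‖fderiv ℝ U z (EuclideanSpace.single i 1)‖ ^ 2) ∧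
      (∫ x, ‖Torus.laplacian (Torus.periodize fun y => c • U (c • (y + -q))) x‖ ^ 2) =
        c ^ 3 * ∫ z, ‖Δ U z‖ ^ 2 := by
  have hc0 : 0 < c := by linarith
  have hUc : HasCompactSupport U :=
    HasCompactSupport.of_support_subset_isCompact (isCompact_closedBall 0 2)
      (subset_closure.trans hUs)
  -- the planted field on `ℝ³`
  have hg : ContDiff ℝ ∞ (fun y => c • U (c • (y + -q))) := contDiff_plant hU c (-q)
  have hgc : HasCompactSupport (fun y => c • U (c • (y + -q))) := hasCompactSupport_plant hc0 hUc (-q)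
  have hgdiv : ∀ z, LinearMap.trace ℝ _ (fderiv ℝ (fun y => c • U (c • (y + -q))) z :
      EuclideanSpace ℝ (Fin 3) →ₗ[ℝ] EuclideanSpace ℝ (Fin 3)) = 0 :=
    trace_fderiv_plant hc0.ne' hdiv (-q)
  -- its support sits in the open unit cube: `B̄(q, 2/c) ⊆ B̄(q, 1/4) ⊆ (0,1)³`
  have hgs : tsupport (fun y => c • U (c • (y + -q))) ⊆ {y | ∀ i, y i ∈ Ioo (0 : ℝ) 1} := by
    intro y hy
    have h1 := tsupport_plant hc0 hUs (-q) hy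
    rw [neg_neg, Metric.mem_closedBall, dist_eq_norm] at h1
    have h2 : ‖y - q‖ < 1 / 2 := by
      have : 2 / c ≤ 1 / 4 := by
        rw [div_le_iff₀ hc0]; linarith
      linarith
    have h3 := (Torus.add_mem_unitCube_of_norm_lt hq h2).2
    simpa using h3
  obtain ⟨hsm, hdf, hzm⟩ := periodize_smooth_divFree_zeroMean hg hgc hgs hgdiv
  refine ⟨hsm, hdf, hzm, ?_, ?_, ?_⟩
  · rw [enstrophyProduction_periodize hg hgs, production_plant U hc0 (-q)]
  · rw [torusEnstrophy_periodize hg hgs, gradNormSq_plant U hc0 (-q)]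
  · rw [laplacianNormSq_periodize hg hgs, laplacianNormSq_plant U hc0 (-q)]

/-- **NO-GO (census row C1; the cell's no-go ledger entry #2).** For EVERY real constant `C`
the Grönwall-closable enstrophy budget

  `dℰ/dt ≤ (C/ν) ℰ²` along every zero-mean classical solution of unforced Navier–Stokes on `T³`

(`EnstrophyQuadraticBudget C`, `RateBudgets.lean`) is FALSE. Proof: plant the whole-space
witness `U` of `QuadraticBudgetWitness.lean` (smooth, divergence free, compactly supported,
production `σ(U) > 0`, obtained WITHOUT evaluating any transcendental integral) at the centre of
the period cell at scales `c = 8n`, `n ≥ 1` (`QuadraticBudgetPlanting.lean`): along this family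
`σ`, `ℰ`, `D = ∫‖Δ·‖²` scale like `n³, n, n³`, so the scale-non-invariant ratio `σ²/(ℰ² D)` is
unbounded, contradicting the static form `σ² ≤ 4 C ℰ² D` of the budget
(`QuadraticBudgetStatic.lean`, dynamic reduction via local existence and the `H¹` balance at
`t = 0`). This is Sieve 1 (space-time scaling) of `Sieves.lean` carried out inside the tree for the
first Grönwall-closable candidate: the degree gap "`2 = s_ℰ + 1 < s_ℰ + 2 = 3`" is realised by an
explicit concentrating family. Search for candidate a priori estimates; no regularity claim — this
is a negative result about ONE candidate inequality, not a statement about solutions. [folklore] -/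
theorem not_enstrophyQuadraticBudget (C : ℝ) : ¬ EnstrophyQuadraticBudget (d := Fin 3) C := by
  obtain ⟨U, hU, hUs, hdiv, hσ⟩ := BumpWitness.exists_compactSupport_divFree_production_pos
  obtain ⟨q, hq⟩ : ∃ q : EuclideanSpace ℝ (Fin 3), ∀ i, q i = 1 / 2 :=
    ⟨WithLp.toLp 2 fun _ => 1 / 2, fun _ => rfl⟩
  -- the planted family at scales `c = 8 n`
  obtain ⟨w, hw⟩ : ∃ w : ℕ → UnitAddTorus (Fin 3) → EuclideanSpace ℝ (Fin 3),
      ∀ n, w n = Torus.periodize fun y => (8 * n : ℝ) • U ((8 * n : ℝ) • (y + -q)) :=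
    ⟨_, fun n => rfl⟩
  have hfacts : ∀ n : ℕ, 1 ≤ n →
      Torus.IsSmooth (w n) ∧ Torus.IsDivFree (w n) ∧ Torus.HasZeroMean (w n) ∧
      enstrophyProduction (w n) = ((8 * n : ℝ)) ^ 3 * ∫ z, ⟪fderiv ℝ U z (U z), Δ U z⟫ ∧
      torusEnstrophy (w n) =
        2⁻¹ * ((8 * n : ℝ) * ∫ z, ∑ i, ‖fderiv ℝ U z (EuclideanSpace.single i 1)‖ ^ 2) ∧
      (∫ x, ‖Torus.laplacian (w n) x‖ ^ 2) = ((8 * n : ℝ)) ^ 3 * ∫ z, ‖Δ U z‖ ^ 2 := by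
    intro n hn
    have hn' : (1 : ℝ) ≤ n := by exact_mod_cast hn
    rw [hw n]
    exact planted_facts hU hUs hdiv hq (by linarith)
  set σU := ∫ z, ⟪fderiv ℝ U z (U z), Δ U z⟫ with hσU
  set GU := ∫ z, ∑ i, ‖fderiv ℝ U z (EuclideanSpace.single i 1)‖ ^ 2 with hGU
  set DU := ∫ z, ‖Δ U z‖ ^ 2 with hDU
  obtain ⟨-, -, -, hσ1, hE1, hD1⟩ := hfacts 1 le_rfl
  refine not_enstrophyQuadraticBudget_of_scaling_family (d := Fin 3) (by simp) (w₁ := w 1) ?_ w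
    (fun n hn => (hfacts n hn).1) (fun n hn => (hfacts n hn).2.1) (fun n hn => (hfacts n hn).2.2.1)
    (fun n hn => ?_) (fun n hn => ?_) (fun n hn => ?_) C
  · rw [hσ1]; positivity
  · rw [(hfacts n hn).2.2.2.1, hσ1]; ring
  · rw [(hfacts n hn).2.2.2.2.1, hE1]; ring
  · rw [(hfacts n hn).2.2.2.2.2, hD1]; ring

end Summit.NavierStokesRegularity.FunctionalMining

end
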